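import Literature.NumberTheory.Rogawski1990.ExplicitFactorProductFormula
import Literature.NumberTheory.Rogawski1990.KottwitzSignTwistedFrameArch
import HarnessLib

/-!
# The archimedean signs `κ‴_w` of Rogawski's canonical factor `Δ‴_∞` at an ADELIC matching pair `(γ_H ⊗ 1, p_∞)` ARE the real-place norm-residue
# symbols `(W_{w|L⁺}, θ)_{w|L⁺}` of the `H′`-value `W` of the transported eigenvector (Rogawski 1990, §14.6 p. 242, §4.3 (4.3.3) p. 44, §3.5 Prop. 3.5.2 (c))

Topic `NumberTheory/Rogawski1990`; namespace `Literature.NumberTheory.Rogawski1990`; **THEOREMS ONLY** (no definition, no named fact, no instance, no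
notation, no `sorry`).  Cell `pub/hodgecm-mathlib`, ENGINE T1 (crux H413 = `stmt-HodgeConjecture-24833`), T6 #72-side node **N5** (the (4.3.3) clause
`GlobalKappaFormula` of ★ `GlobalTransferWithCartanKappaFormula` at `Δ‴ := finExplicitCollection`, `Δ‴_∞ := archCanonicalDelta`; desk TABLE #4,
F0P3a-p04 (g8)), part **(A2)** = the ARCHIMEDEAN places: ★ `archKappaSignAt` (the `η`-free sign `sgn Re tr(P_wᴴ · w(H′) · P_w)` of ★ `archCanonicalDelta`)
at `(γ_H ⊗ 1, p_∞)` for a rational `G`-regular `γ_H ∈ H(L⁺)` and a matching ADÈLE `p` equals the Hilbert symbol `(W_{w₀}, θ)_{w₀}` at the real place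
`w₀ = w|_{L⁺}` under the complex place `w`, `L = L⁺(√θ)` (`θ` = ★ `cmQuadraticGenerator`, totally negative), of the idèle `W ∈ 𝕀_{L⁺}` below the `H′`-value
`⟨g(v₀⊗1), g(v₀⊗1)⟩_{H′⊗1}` of the transported eigenvector (★ `MatchingAdeleG₂.exists_ideleBaseChange_eq_hermForm`).  Twin of part (A1)
(`FinExplicitKappaObstruction`, F0P3a-p04: the finite places).  HC_CM is proved only modulo the printed citations until rung 0 closes.

THE MATHEMATICS.  `p = g(γ₀ ⊗ 1)g⁻¹` adelically and `γ₀ v₀ = u v₀` (`u = (γ_H.2)₀₀`) give `p · g(v₀⊗1) = (u⊗1) · g(v₀⊗1)`; at the complex place `w`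
(`φ_w = ev_w ∘ π_∞ : (AdeleRing (𝓞 L) L)_L → ℂ`, ★ `toMixed_eq_map`) the vector `p′ = φ_w(g(v₀⊗1)) ≠ 0` is a `σ_w(u)`-eigenvector of `p_w`, hence
`P_w p′ = χ_g(u)_w · p′` for the projector `P_w = p_w² − tr(g_w) p_w + det(g_w)` (Mathlib `charpoly_fin_two`, ★ `archGammaTwo_rationalArch`,
★ `archCharpolyTwo_rationalArch`) with `χ_g(u) ≠ 0` (★ `eval_charpoly_gammaTwo_ne_zero_of_isGRegular`).  Since `P_w = v qᵀ` has rank one (★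
`archEigenlineProjector_eq_vecMulVec_of_conj_eq`), `p′ = λ v` with `λ ≠ 0`, so `sgn Re tr(P_wᴴ H P_w) = sgn Re(‖q‖² vᴴHv) = sgn Re(p′ᴴ H p′)` (`vᴴHv ∈ ℝˣ`,
★ `star_dotProduct_form_mulVec_ne_zero_of_conj_eq`) — no uniqueness of the eigenline is needed.  Finally `p′ᴴ σ_w(H′) p′ = φ_w(⟨g(v₀⊗1), g(v₀⊗1)⟩_{H′⊗1})
= φ_w(W ⊗ 1) = ι(W_{w₀}) ∈ ℝ` (★ `evalC_ringEquiv_mixedSpace_ideleBaseChange`) and, `θ` being negative at `w₀`, `sgn ι(W_{w₀}) = (W_{w₀}, θ)_{w₀}` (★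
`hilbertSymbol_map_ringEquiv`, ★ `Real.hilbertSymbol_eq_one_iff`).  Print [§14.6 p. 242]: «`κ(γ, ψ_v(i(γ)))` is equal to `±1`» — here at `v ∣ ∞`.

* §1 `hilbertSymbol_completion_eq_sign_ringEquivRealOfIsReal` (real place, LOCAL element: `(t, d)_{w₀} = sgn t` for `σ_{w₀}(d) < 0`).
* §2 **`MatchingAdele.archKappaSignAt_arch_eq_hilbertSymbol`** (`κ‴_w(γ_H ⊗ 1, p_∞) = (W_{w₀}, θ)_{w₀}`, every complex `w`; `w₀` spelled
  `IsCMField.equivInfinitePlace L w`) and **`…_comap`** (the `w.1.comap`∕`ideleInfiniteComponent` spelling).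
Sequel (B) (F0P3a-p04): `∏_v κ_v · ∏_w κ‴_w = (−1)^{[W]} = (e 𝒪H)(obs p)` and the (4.3.3) clause.

## References
* [Rogawski1990] J. D. Rogawski, *Automorphic Representations of Unitary Groups in Three Variables*, Ann. of Math. Stud. 123 (1990), §3.3 (3.3.1) p. 22; §3.5
  Prop. 3.5.2 (c) p. 29; §4.3 (4.3.3) p. 44; §4.9 p. 55; §14.6 p. 242.
* [LanglandsShelstad1987] R. P. Langlands, D. Shelstad, *On the definition of transfer factors*, Math. Ann. 278 (1987), §2, §6.3–6.4.
* [Omeara1963] O. T. O'Meara, *Introduction to Quadratic Forms* (1963), §63B (the Hilbert symbol over `ℝ`).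
* [CasselsFrohlichANT1967] Cassels–Fröhlich (eds.), *Algebraic Number Theory* (1967), Ch. II §10–§11.
-/

set_option autoImplicit false

noncomputable section

open NumberField NumberField.InfinitePlace IsDedekindDomain Matrix Polynomial
open Literature.NumberTheory.GaloisRepresentations Literature.NumberTheory.QuadraticForms
open scoped MatrixGroups ComplexOrder

namespace Literature.NumberTheory.Rogawski1990

open Literature.NumberTheory.Automorphic Literature.LinearAlgebra.Matrix
open Literature.AlgebraicGeometry.ShimuraVarieties (unitaryGroup hermForm)

/-! ## §1 Two small letters: the Hilbert symbol of a LOCAL element at a real place, and `(v qᵀ) x = (q·x) v` -/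

section Letters

/-- **At a real place `w₀` with `σ_{w₀}(d) < 0`, `(t, d)_{w₀} = sgn t` for EVERY non-zero `t ∈ K_{w₀}`** (not only global ones: transport along
`K_{w₀} ≃+* ℝ`, Mathlib `ringEquivRealOfIsReal`, and `(a, b)_ℝ = 1 ↔ a > 0 ∨ b > 0`, ★ `Real.hilbertSymbol_eq_one_iff`). [cite: Omeara1963, §63B] -/
theorem hilbertSymbol_completion_eq_sign_ringEquivRealOfIsReal {K : Type*} [Field K] [NumberField K] {w₀ : InfinitePlace K} (hw : w₀.IsReal)
    {t : w₀.Completion} (ht : t ≠ 0) {d : K} (hd : InfinitePlace.embedding_of_isReal hw d < 0) :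
    hilbertSymbol w₀.Completion t (algebraMap K w₀.Completion d) =
      ((SignType.sign (InfinitePlace.Completion.ringEquivRealOfIsReal hw t) : SignType) : ℤ) := by
  set E := InfinitePlace.Completion.ringEquivRealOfIsReal hw with hE
  have ht0 : E t ≠ 0 := (map_ne_zero_iff _ E.injective).2 ht
  have key : hilbertSymbol w₀.Completion t (algebraMap K w₀.Completion d) = hilbertSymbol ℝ (E t) (InfinitePlace.embedding_of_isReal hw d) := by
    rw [← hilbertSymbol_map_ringEquiv E, hE, ringEquivRealOfIsReal_algebraMap]
  rw [key]
  rcases lt_or_gt_of_ne ht0 with hlt | hgt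
  · rw [sign_neg hlt, SignType.coe_neg_one]
    rcases hilbertSymbol_eq_one_or_eq_neg_one (E t) (InfinitePlace.embedding_of_isReal hw d) with h1 | h1
    · exact absurd ((Real.hilbertSymbol_eq_one_iff _ _).1 h1) (not_or.2 ⟨not_lt.2 hlt.le, not_lt.2 hd.le⟩)
    · exact h1
  · rw [sign_pos hgt, SignType.coe_one]
    exact (Real.hilbertSymbol_eq_one_iff _ _).2 (Or.inl hgt)

/-- The determinant of a pushed-forward matrix (bookkeeping). [folklore] -/
private theorem det_map_ringHom' {R S : Type*} [CommRing R] [CommRing S] (f : R →+* S) {n : ℕ} (M : Matrix (Fin n) (Fin n) R) :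
    (M.map f).det = f M.det := by
  rw [RingHom.map_det, RingHom.mapMatrix_apply]

/-- The trace of a pushed-forward matrix (bookkeeping). [folklore] -/
private theorem trace_map_ringHom' {R S : Type*} [CommRing R] [CommRing S] (f : R →+* S) {n : ℕ} (M : Matrix (Fin n) (Fin n) R) :
    (M.map f).trace = f M.trace := by
  simp only [Matrix.trace, Matrix.diag_apply, Matrix.map_apply, map_sum]

/-- `(v qᵀ) x = (q · x) v`. [folklore] -/
private theorem vecMulVec_mulVec_eq_smul {n : Type*} [Fintype n] {R : Type*} [CommSemiring R] (v q x : n → R) :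
    vecMulVec v q *ᵥ x = (q ⬝ᵥ x) • v := by
  funext i
  simp only [Matrix.mulVec, vecMulVec_apply, dotProduct, Pi.smul_apply, smul_eq_mul, Finset.sum_mul]
  exact Finset.sum_congr rfl fun j _ => by ring

end Letters

/-! ## §2 `κ‴_w(γ_H ⊗ 1, p_∞) = (W_{w|L⁺}, θ)_{w|L⁺}` -/

section Arch

variable {L : Type} [Field L] [NumberField L] [IsCMField L] {H' : Matrix (Fin 3) (Fin 3) L}
  {γH : (UnitaryGroup.cmDatum L 2 (Matrix.of fun i j : Fin 2 => if i.val + j.val + 1 = 2 then (1 : L) else 0)).Rational ×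
    (UnitaryGroup.cmDatum L 1 (Matrix.of fun i j : Fin 1 => if i.val + j.val + 1 = 1 then (1 : L) else 0)).Rational}
  {γ₀ : (UnitaryGroup.cmDatum L 3 H').Rational}

/-- **THE ARCHIMEDEAN SIGN OF THE CANONICAL FACTOR AT AN ADELIC MATCHING PAIR IS A HILBERT SYMBOL.**  For a `c`-hermitian anisotropic `H′`, a rational
`G`-regular `γ_H ∈ H(L⁺)`, a matching adèle `p` (★ `MatchingAdele`) with an adelic conjugator `g` over a rational `γ₀ ∈ U(H′)(L⁺)` (`g (γ₀ ⊗ 1) g⁻¹ = p`), a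
`u`-eigenvector `v₀` of `γ₀` (`u = (γ_H.2)₀₀`), and the idèle `W ∈ 𝕀_{L⁺}` with `W ⊗ 1 = ⟨g(v₀⊗1), g(v₀⊗1)⟩_{H′⊗1}`: at every complex place `w` of `L`,
`κ‴_w(γ_H ⊗ 1, p_∞) = (W_{w₀}, θ)_{w₀}`, `w₀ = w|_{L⁺}` (Mathlib `IsCMField.equivInfinitePlace`, the spelling of ★ `exists_kappa_eq_hilbertSymbol`), `θ` the CM
generator — the summand of ★ `quadraticArtinIndicator_eq_zero_iff_prod_hilbertSymbol_eq_one` at `X := W`, `d := θ` (file header for the route; the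
`w.1.comap`∕`ideleInfiniteComponent` spelling is `…_comap` below, definitionally the same). [cite: Rogawski1990, §14.6 p. 242; §3.5 Prop. 3.5.2 (c) p. 29; §4.3 (4.3.3) p. 44] [cite: LanglandsShelstad1987, §2] -/
theorem MatchingAdele.archKappaSignAt_arch_eq_hilbertSymbol (p : MatchingAdele L H' γH)
    (hherm : (H'.map (cmConjRingHom L)).transpose = H') (hanis : ∀ x : Fin 3 → L, hermForm (cmConjRingHom L) H' x x = 0 → x = 0)
    (hGreg : IsGRegular (cmConjRingHom L) (Matrix.of fun i j : Fin 2 => if i.val + j.val + 1 = 2 then (1 : L) else 0)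
        (Matrix.of fun i j : Fin 1 => if i.val + j.val + 1 = 1 then (1 : L) else 0)
        (Matrix.of fun i j : Fin 3 => if i.val + j.val + 1 = 3 then (1 : L) else 0) endoForm_antidiagOne γH)
    {g : GL (Fin 3) (AdeleRing (𝓞 L) L)}
    (hg : g * (((UnitaryGroup.cmDatum L 3 H').toAdelic γ₀).val : GL (Fin 3) (AdeleRing (𝓞 L) L)) * g⁻¹ = (p.adele.val : GL (Fin 3) (AdeleRing (𝓞 L) L)))
    {v₀ : Fin 3 → L}
    (hv₀ : (((γ₀ : unitaryGroup (cmConjRingHom L) H').val : GL (Fin 3) L) : Matrix (Fin 3) (Fin 3) L) *ᵥ v₀ = ((γH.2.val.val : Matrix (Fin 1) (Fin 1) L) 0 0) • v₀)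
    (hv₀0 : v₀ ≠ 0) (W : (AdeleRing (𝓞 ↥(maximalRealSubfield L)) ↥(maximalRealSubfield L))ˣ)
    (hW : ((AdeleRing.ideleBaseChange (↥(maximalRealSubfield L)) L W : (AdeleRing (𝓞 L) L)ˣ) : AdeleRing (𝓞 L) L) =
      hermForm (adeleConj L) (H'.map (algebraMap L (AdeleRing (𝓞 L) L)))
        ((g : Matrix (Fin 3) (Fin 3) (AdeleRing (𝓞 L) L)) *ᵥ ((algebraMap L (AdeleRing (𝓞 L) L)) ∘ v₀))
        ((g : Matrix (Fin 3) (Fin 3) (AdeleRing (𝓞 L) L)) *ᵥ ((algebraMap L (AdeleRing (𝓞 L) L)) ∘ v₀)))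
    (w : {w : InfinitePlace L // IsComplex w}) :
    archKappaSignAt L H' (rationalArch L γH) w p.arch =
      hilbertSymbol (IsCMField.equivInfinitePlace L w.1).Completion
        (((W : (AdeleRing (𝓞 ↥(maximalRealSubfield L)) ↥(maximalRealSubfield L))ˣ) : AdeleRing (𝓞 ↥(maximalRealSubfield L)) ↥(maximalRealSubfield L)).1
          (IsCMField.equivInfinitePlace L w.1))
        (algebraMap ↥(maximalRealSubfield L) _ (cmQuadraticGenerator L : ↥(maximalRealSubfield L))) := by
  classical
  -- the real place under `w` is `w|_{L⁺}` and the `w₀`-coordinate of `W` is `ideleInfiniteComponent` (both definitional)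
  show archKappaSignAt L H' (rationalArch L γH) w p.arch =
      hilbertSymbol (w.1.comap (algebraMap ↥(maximalRealSubfield L) L)).Completion
        ((ideleInfiniteComponent (↥(maximalRealSubfield L)) (w.1.comap (algebraMap ↥(maximalRealSubfield L) L)) W :
            (w.1.comap (algebraMap ↥(maximalRealSubfield L) L)).Completion))
        (algebraMap ↥(maximalRealSubfield L) _ (cmQuadraticGenerator L : ↥(maximalRealSubfield L)))
  -- LETTERS at `w`: `φ = ev_w ∘ π_∞ : (AdeleRing (𝓞 L) L)_L → ℂ`, `F = φ ∘ ι = σ_w`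
  set πinf : (AdeleRing (𝓞 L) L) →+* mixedEmbedding.mixedSpace L := (InfiniteAdeleRing.ringEquiv_mixedSpace L).toRingHom.comp (UnitaryGroup.adeleFst L)
    with hπinf
  set φ : (AdeleRing (𝓞 L) L) →+* ℂ := (UnitaryGroup.evalC L w).comp πinf with hφdef
  have hFemb : ∀ r : L, φ (algebraMap L (AdeleRing (𝓞 L) L) r) = w.1.embedding r := fun r => by
    show UnitaryGroup.evalC L w (InfiniteAdeleRing.ringEquiv_mixedSpace L (UnitaryGroup.adeleFst L (algebraMap L (AdeleRing (𝓞 L) L) r))) = _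
    rw [show UnitaryGroup.adeleFst L (algebraMap L (AdeleRing (𝓞 L) L) r) = (algebraMap L (AdeleRing (𝓞 L) L) r).1 from rfl, QuadraticForms.ringEquiv_mixedSpace_fst_algebraMap,
      UnitaryGroup.evalC_apply, NumberField.mixedEmbedding.mixedEmbedding_apply_isComplex]
  have hφσ : ∀ x : (AdeleRing (𝓞 L) L), φ (adeleConj L x) = starRingEnd ℂ (φ x) := fun x => by
    show UnitaryGroup.evalC L w (InfiniteAdeleRing.ringEquiv_mixedSpace L (UnitaryGroup.adeleFst L (adeleConj L x))) =
      starRingEnd ℂ (UnitaryGroup.evalC L w (InfiniteAdeleRing.ringEquiv_mixedSpace L (UnitaryGroup.adeleFst L x)))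
    rw [show UnitaryGroup.adeleFst L (adeleConj L x) = (adeleConj L x).1 from rfl, show UnitaryGroup.adeleFst L x = x.1 from rfl,
      QuadraticForms.ringEquiv_mixedSpace_fst_adeleConj,
      UnitaryGroup.evalC_conjMixed _ L _ (UnitaryGroup.complexConj_smul_infinitePlace L w.1) (IsCMField.complexConj_ne_one L)]
  have hφmap : ∀ M : Matrix (Fin 3) (Fin 3) (AdeleRing (𝓞 L) L), (M.map πinf).map (UnitaryGroup.evalC L w) = M.map φ := fun M => by
    rw [hφdef, Matrix.map_map]; rfl
  -- the idèle coordinate: `φ(W ⊗ 1) = ι(W_{w₀}) ∈ ℝ`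
  have hWφ : φ ((AdeleRing.ideleBaseChange (↥(maximalRealSubfield L)) L W : (AdeleRing (𝓞 L) L)ˣ) : AdeleRing (𝓞 L) L) =
      (((InfinitePlace.Completion.ringEquivRealOfIsReal (IsTotallyReal.isReal (w.1.comap (algebraMap (↥(maximalRealSubfield L)) L))))
          (ideleInfiniteComponent (↥(maximalRealSubfield L)) (w.1.comap (algebraMap (↥(maximalRealSubfield L)) L)) W :
            (w.1.comap (algebraMap (↥(maximalRealSubfield L)) L)).Completion) : ℝ) : ℂ) :=
    evalC_ringEquiv_mixedSpace_ideleBaseChange w W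
  clear_value φ
  -- the archimedean pair, the conjugator `c`, the rank-one projector `P_w = v qᵀ`
  set a := rationalArch L γH with hadef
  set b := p.arch with hbdef
  have hp' := p.isArchNormPair
  rw [isArchNormPair_iff] at hp'
  obtain ⟨c, hc⟩ := isConj_iff.1 hp'
  have hreg : IsArchGRegular L a := isArchGRegular_cmRationalToArch_of_isGRegular L γH hGreg
  set H : Matrix (Fin 3) (Fin 3) ℂ := H'.map w.1.embedding with hH
  set v : Fin 3 → ℂ := fun i => UnitaryGroup.evalC L w ((c : Matrix (Fin 3) (Fin 3) (mixedEmbedding.mixedSpace L)) i 1) with hv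
  set s : ℂ := UnitaryGroup.evalC L w ((archCharpolyTwo L a).eval (archGammaTwo L a)) with hsdef
  set q : Fin 3 → ℂ := fun j => s * UnitaryGroup.evalC L w (((c⁻¹ : GL (Fin 3) (mixedEmbedding.mixedSpace L)) :
      Matrix (Fin 3) (Fin 3) (mixedEmbedding.mixedSpace L)) 1 j) with hq
  have hPvq : archEigenlineProjector L H' a w b = vecMulVec v q := archEigenlineProjector_eq_vecMulVec_of_conj_eq L H' a b w c hc
  -- `z = vᴴ H v` is real and non-zero
  have hz : star v ⬝ᵥ H *ᵥ v ≠ 0 := star_dotProduct_form_mulVec_ne_zero_of_conj_eq L H' a b w hanis hreg c hc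
  have hHφ : H = (H'.map (algebraMap L (AdeleRing (𝓞 L) L))).map φ := by
    rw [hH, Matrix.map_map]; exact congrArg H'.map (funext fun r => (hFemb r).symm)
  have hHh : Hᴴ = H := by
    have hcomp : (star : ℂ → ℂ) ∘ (w.1.embedding : L → ℂ) = (w.1.embedding : L → ℂ) ∘ (cmConjRingHom L : L → L) := by
      funext x
      simp only [Function.comp_apply, embedding_cmConjRingHom, Complex.star_def]
    rw [hH, Matrix.conjTranspose, Matrix.transpose_map, Matrix.map_map, hcomp, ← Matrix.map_map, ← Matrix.transpose_map, hherm]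
  have hzz : star (star v ⬝ᵥ H *ᵥ v) = star v ⬝ᵥ H *ᵥ v := by
    rw [← Matrix.star_dotProduct_star, star_star, Matrix.star_mulVec, hHh, ← Matrix.dotProduct_mulVec]
  have hzre : (((star v ⬝ᵥ H *ᵥ v).re : ℝ) : ℂ) = star v ⬝ᵥ H *ᵥ v := Complex.conj_eq_iff_re.1 (by rw [← Complex.star_def]; exact hzz)
  -- the transported eigenvector `p′ = φ(g(v₀ ⊗ 1))` and the matrix `p_w = φ(p)`
  set xA : Fin 3 → (AdeleRing (𝓞 L) L) := (g : Matrix (Fin 3) (Fin 3) (AdeleRing (𝓞 L) L)) *ᵥ ((algebraMap L (AdeleRing (𝓞 L) L)) ∘ v₀) with hxA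
  set p' : Fin 3 → ℂ := φ ∘ xA with hp'def
  set A : Matrix (Fin 3) (Fin 3) (AdeleRing (𝓞 L) L) := ((p.adele.val : GL (Fin 3) (AdeleRing (𝓞 L) L)) : Matrix (Fin 3) (Fin 3) (AdeleRing (𝓞 L) L)) with hA
  set u : L := (γH.2.val.val : Matrix (Fin 1) (Fin 1) L) 0 0 with hu
  -- (i) the adelic eigen-equation `p · g(v₀⊗1) = (u⊗1) · g(v₀⊗1)`, mapped to `w`
  have hγA : ((((UnitaryGroup.cmDatum L 3 H').toAdelic γ₀).val : GL (Fin 3) (AdeleRing (𝓞 L) L)) : Matrix (Fin 3) (Fin 3) (AdeleRing (𝓞 L) L)) =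
      (((γ₀ : unitaryGroup (cmConjRingHom L) H').val : GL (Fin 3) L) : Matrix (Fin 3) (Fin 3) L).map (algebraMap L (AdeleRing (𝓞 L) L)) := rfl
  have hAG' : (p.adele.val : GL (Fin 3) (AdeleRing (𝓞 L) L)) * g = g * (((UnitaryGroup.cmDatum L 3 H').toAdelic γ₀).val) := by
    rw [← hg, inv_mul_cancel_right]
  have hAG : A * (g : Matrix (Fin 3) (Fin 3) (AdeleRing (𝓞 L) L)) =
      (g : Matrix (Fin 3) (Fin 3) (AdeleRing (𝓞 L) L)) * ((((UnitaryGroup.cmDatum L 3 H').toAdelic γ₀).val : GL (Fin 3) (AdeleRing (𝓞 L) L)) :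
        Matrix (Fin 3) (Fin 3) (AdeleRing (𝓞 L) L)) := by
    have h := congrArg (fun M : GL (Fin 3) (AdeleRing (𝓞 L) L) => (M : Matrix (Fin 3) (Fin 3) (AdeleRing (𝓞 L) L))) hAG'
    simpa only [Units.val_mul] using h
  have heigA : A *ᵥ xA = (algebraMap L (AdeleRing (𝓞 L) L) u) • xA := by
    rw [hxA, Matrix.mulVec_mulVec, hAG, ← Matrix.mulVec_mulVec, hγA]
    have h1 : (((γ₀ : unitaryGroup (cmConjRingHom L) H').val : GL (Fin 3) L) : Matrix (Fin 3) (Fin 3) L).map (algebraMap L (AdeleRing (𝓞 L) L)) *ᵥ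
        ((algebraMap L (AdeleRing (𝓞 L) L)) ∘ v₀) = (algebraMap L (AdeleRing (𝓞 L) L)) ∘ ((((γ₀ : unitaryGroup (cmConjRingHom L) H').val : GL (Fin 3) L) :
          Matrix (Fin 3) (Fin 3) L) *ᵥ v₀) := by
      funext i; exact (RingHom.map_mulVec (algebraMap L (AdeleRing (𝓞 L) L)) _ v₀ i).symm
    rw [h1, hv₀]
    have h2 : (algebraMap L (AdeleRing (𝓞 L) L)) ∘ (u • v₀) = (algebraMap L (AdeleRing (𝓞 L) L) u) • ((algebraMap L (AdeleRing (𝓞 L) L)) ∘ v₀) := by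
      funext i; simp only [Function.comp_apply, Pi.smul_apply, smul_eq_mul, map_mul]
    rw [h2, Matrix.mulVec_smul]
  have heig : A.map φ *ᵥ p' = (w.1.embedding u) • p' := by
    have h1 : A.map φ *ᵥ p' = φ ∘ (A *ᵥ xA) := by
      funext i; exact (RingHom.map_mulVec φ A xA i).symm
    rw [h1, heigA, ← hFemb u]
    funext i; simp only [Function.comp_apply, Pi.smul_apply, smul_eq_mul, map_mul, hp'def]
  -- (ii) `p′ ≠ 0`
  have hp'0 : p' ≠ 0 := by
    have hGx : p' = (g : Matrix (Fin 3) (Fin 3) (AdeleRing (𝓞 L) L)).map φ *ᵥ (φ ∘ ((algebraMap L (AdeleRing (𝓞 L) L)) ∘ v₀)) := by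
      funext i; exact RingHom.map_mulVec φ _ _ i
    have hdet : IsUnit ((g : Matrix (Fin 3) (Fin 3) (AdeleRing (𝓞 L) L)).map φ).det := by
      rw [← RingHom.mapMatrix_apply, ← RingHom.map_det]; exact (Matrix.isUnits_det_units g).map φ
    intro h0
    have hker : φ ∘ ((algebraMap L (AdeleRing (𝓞 L) L)) ∘ v₀) = 0 := by
      have h := congrArg (fun y => ((g : Matrix (Fin 3) (Fin 3) (AdeleRing (𝓞 L) L)).map φ)⁻¹ *ᵥ y) (hGx.symm.trans h0)
      simpa only [Matrix.mulVec_mulVec, Matrix.nonsing_inv_mul _ hdet, Matrix.one_mulVec, Matrix.mulVec_zero] using h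
    apply hv₀0
    funext i
    have hi := congrFun hker i
    simp only [Function.comp_apply, Pi.zero_apply, hFemb] at hi
    exact (map_eq_zero_iff _ (w.1.embedding).injective).1 hi
  -- (iii) `P_w p′ = χ_g(u)_w · p′`
  have hxw : ((b : GL (Fin 3) (mixedEmbedding.mixedSpace L)) : Matrix (Fin 3) (Fin 3) (mixedEmbedding.mixedSpace L)).map (UnitaryGroup.evalC L w) =
      A.map φ := by
    have h1 : (b : GL (Fin 3) (mixedEmbedding.mixedSpace L)) = GLn.toMixed 3 L (p.adele.val : GL (Fin 3) (AdeleRing (𝓞 L) L)) := rfl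
    rw [h1, toMixed_eq_map]
    exact hφmap _
  have hs : s = w.1.embedding u * w.1.embedding u - w.1.embedding ((γH.1.val.val : Matrix (Fin 2) (Fin 2) L).trace) * w.1.embedding u +
      w.1.embedding ((γH.1.val.val : Matrix (Fin 2) (Fin 2) L).det) := by
    rw [hsdef, hadef, archCharpolyTwo_rationalArch, archGammaTwo_rationalArch, Polynomial.eval_map, Polynomial.eval₂_hom, UnitaryGroup.evalC_apply,
      NumberField.mixedEmbedding.mixedEmbedding_apply_isComplex, Matrix.charpoly_fin_two]
    simp only [eval_add, eval_sub, eval_mul, eval_pow, eval_C, eval_X, map_add, map_sub, map_mul, map_pow, ← hu]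
    ring
  have hgw : ((a.1 : GL (Fin 2) (mixedEmbedding.mixedSpace L)) : Matrix (Fin 2) (Fin 2) (mixedEmbedding.mixedSpace L)).map (UnitaryGroup.evalC L w) =
      (γH.1.val.val : Matrix (Fin 2) (Fin 2) L).map w.1.embedding := by
    rw [hadef]
    unfold rationalArch
    simp only []
    rw [coe_coe_cmRationalToArch, map_mixedEmbedding_map_evalC]
  have hPp' : archEigenlineProjector L H' a w b *ᵥ p' = s • p' := by
    have hPdef : archEigenlineProjector L H' a w b = A.map φ * A.map φ -
        (((a.1 : GL (Fin 2) (mixedEmbedding.mixedSpace L)) : Matrix (Fin 2) (Fin 2) (mixedEmbedding.mixedSpace L)).map (UnitaryGroup.evalC L w)).trace •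
          A.map φ + (((a.1 : GL (Fin 2) (mixedEmbedding.mixedSpace L)) : Matrix (Fin 2) (Fin 2) (mixedEmbedding.mixedSpace L)).map
            (UnitaryGroup.evalC L w)).det • (1 : Matrix (Fin 3) (Fin 3) ℂ) := by
      rw [← hxw]; rfl
    rw [hPdef, hgw, trace_map_ringHom', det_map_ringHom', Matrix.add_mulVec, Matrix.sub_mulVec, Matrix.smul_mulVec, Matrix.smul_mulVec,
      Matrix.one_mulVec, ← Matrix.mulVec_mulVec, heig, Matrix.mulVec_smul, heig, smul_smul, smul_smul, hs]
    rw [← sub_smul, ← add_smul]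
  -- (iv) `p′ = λ v`, `λ ≠ 0`
  have hs0 : s ≠ 0 := by
    rw [hsdef, hadef, archCharpolyTwo_rationalArch, archGammaTwo_rationalArch, Polynomial.eval_map, Polynomial.eval₂_hom, UnitaryGroup.evalC_apply,
      NumberField.mixedEmbedding.mixedEmbedding_apply_isComplex]
    exact (map_ne_zero w.1.embedding).2 (eval_charpoly_gammaTwo_ne_zero_of_isGRegular L γH hGreg)
  have hlam : p' = (s⁻¹ * (q ⬝ᵥ p')) • v := by
    have h := hPp'
    rw [hPvq, vecMulVec_mulVec_eq_smul] at h
    rw [mul_smul, h, smul_smul, inv_mul_cancel₀ hs0, one_smul]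
  set lam : ℂ := s⁻¹ * (q ⬝ᵥ p') with hlamdef
  have hlam0 : lam ≠ 0 := fun h0 => hp'0 (by rw [hlam, h0, zero_smul])
  -- (v) `p′ᴴ H p′ = |λ|² vᴴ H v` and `p′ᴴ H p′ = φ(W ⊗ 1) = ι(W_{w₀})`
  have hform : star p' ⬝ᵥ H *ᵥ p' = ((Complex.normSq lam : ℝ) : ℂ) * (star v ⬝ᵥ H *ᵥ v) := by
    rw [hlam, star_smul, Matrix.mulVec_smul, dotProduct_smul, smul_dotProduct, smul_smul, smul_eq_mul, Complex.star_def,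
      Complex.normSq_eq_conj_mul_self, mul_comm ((starRingEnd ℂ) _) _]
  have hformW : star p' ⬝ᵥ H *ᵥ p' = φ ((AdeleRing.ideleBaseChange (↥(maximalRealSubfield L)) L W : (AdeleRing (𝓞 L) L)ˣ) : AdeleRing (𝓞 L) L) := by
    rw [hW]
    unfold hermForm
    rw [RingHom.map_dotProduct, hHφ]
    have h1 : φ ∘ (H'.map (algebraMap L (AdeleRing (𝓞 L) L)) *ᵥ xA) = (H'.map (algebraMap L (AdeleRing (𝓞 L) L))).map φ *ᵥ p' := by
      funext i; exact RingHom.map_mulVec φ _ _ i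
    have h2 : φ ∘ (⇑(adeleConj L) ∘ xA) = star p' := by
      funext i; simp only [Function.comp_apply, Pi.star_apply, hp'def, hφσ, Complex.star_def]
    rw [h1, h2]
  -- (vi) assemble: both sides are the sign of `ι(W_{w₀})`
  have hQ : 0 < ∑ i, Complex.normSq (q i) := by
    have hqq : q ≠ 0 := by
      intro hq0
      apply hp'0
      rw [hlam, hlamdef, hq0, zero_dotProduct, mul_zero, zero_smul]
    refine lt_of_le_of_ne (Finset.sum_nonneg fun i _ => Complex.normSq_nonneg _) (fun h => hqq ?_)
    funext i
    have hi : Complex.normSq (q i) = 0 := by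
      have := (Finset.sum_eq_zero_iff_of_nonneg fun j _ => Complex.normSq_nonneg (q j)).1 h.symm i (Finset.mem_univ i)
      exact this
    exact Complex.normSq_eq_zero.1 hi
  have htr : ((vecMulVec v q)ᴴ * H * vecMulVec v q).trace = ((∑ i, Complex.normSq (q i) : ℝ) : ℂ) * (star v ⬝ᵥ H *ᵥ v) := by
    rw [conjTranspose_vecMulVec, vecMulVec_mul, vecMulVec_mul_vecMulVec, trace_vecMulVec, dotProduct_smul, ← dotProduct_mulVec, smul_eq_mul,
      mul_comm, Complex.ofReal_sum]
    congr 1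
    simp only [dotProduct, Pi.star_apply, Complex.star_def, Complex.normSq_eq_conj_mul_self]
  have hL : 0 < Complex.normSq lam := Complex.normSq_pos.2 hlam0
  have hWne : (ideleInfiniteComponent (↥(maximalRealSubfield L)) (w.1.comap (algebraMap ↥(maximalRealSubfield L) L)) W :
      (w.1.comap (algebraMap ↥(maximalRealSubfield L) L)).Completion) ≠ 0 := by
    exact Units.ne_zero _
  unfold archKappaSignAt
  rw [hPvq, htr, Complex.re_ofReal_mul, sign_mul, sign_pos hQ, one_mul,
    hilbertSymbol_completion_eq_sign_ringEquivRealOfIsReal (IsTotallyReal.isReal _) hWne (embedding_cmQuadraticGenerator_lt_zero' L _ _)]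
  -- `sign (vᴴHv).re = sign (p′ᴴHp′).re = sign ι(W_{w₀})`
  have hre : (star p' ⬝ᵥ H *ᵥ p').re = Complex.normSq lam * (star v ⬝ᵥ H *ᵥ v).re := by
    rw [hform, Complex.re_ofReal_mul]
  have hre' : (star p' ⬝ᵥ H *ᵥ p').re = (InfinitePlace.Completion.ringEquivRealOfIsReal (IsTotallyReal.isReal (w.1.comap (algebraMap (↥(maximalRealSubfield L)) L))))
      (ideleInfiniteComponent (↥(maximalRealSubfield L)) (w.1.comap (algebraMap (↥(maximalRealSubfield L)) L)) W :
        (w.1.comap (algebraMap (↥(maximalRealSubfield L)) L)).Completion) := by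
    rw [hformW, hWφ, Complex.ofReal_re]
  rw [← hre', hre, sign_mul, sign_pos hL, one_mul]

/-- **The same, indexed by `w.1.comap (algebraMap L⁺ L)` with the `ideleInfiniteComponent` letter** — the summand of ★
`quadraticArtinIndicator_eq_zero_iff_prod_hilbertSymbol_eq_one` VERBATIM under the complex-to-real bijection of ★ `KottwitzSignReadsObs` §1
(definitionally equal to the head; both spellings for the (B) assembly). [cite: Rogawski1990, §14.6 p. 242; §4.3 (4.3.3) p. 44] -/
theorem MatchingAdele.archKappaSignAt_arch_eq_hilbertSymbol_comap (p : MatchingAdele L H' γH)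
    (hherm : (H'.map (cmConjRingHom L)).transpose = H') (hanis : ∀ x : Fin 3 → L, hermForm (cmConjRingHom L) H' x x = 0 → x = 0)
    (hGreg : IsGRegular (cmConjRingHom L) (Matrix.of fun i j : Fin 2 => if i.val + j.val + 1 = 2 then (1 : L) else 0)
        (Matrix.of fun i j : Fin 1 => if i.val + j.val + 1 = 1 then (1 : L) else 0)
        (Matrix.of fun i j : Fin 3 => if i.val + j.val + 1 = 3 then (1 : L) else 0) endoForm_antidiagOne γH)
    {g : GL (Fin 3) (AdeleRing (𝓞 L) L)}
    (hg : g * (((UnitaryGroup.cmDatum L 3 H').toAdelic γ₀).val : GL (Fin 3) (AdeleRing (𝓞 L) L)) * g⁻¹ = (p.adele.val : GL (Fin 3) (AdeleRing (𝓞 L) L)))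
    {v₀ : Fin 3 → L}
    (hv₀ : (((γ₀ : unitaryGroup (cmConjRingHom L) H').val : GL (Fin 3) L) : Matrix (Fin 3) (Fin 3) L) *ᵥ v₀ = ((γH.2.val.val : Matrix (Fin 1) (Fin 1) L) 0 0) • v₀)
    (hv₀0 : v₀ ≠ 0) (W : (AdeleRing (𝓞 ↥(maximalRealSubfield L)) ↥(maximalRealSubfield L))ˣ)
    (hW : ((AdeleRing.ideleBaseChange (↥(maximalRealSubfield L)) L W : (AdeleRing (𝓞 L) L)ˣ) : AdeleRing (𝓞 L) L) =
      hermForm (adeleConj L) (H'.map (algebraMap L (AdeleRing (𝓞 L) L)))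
        ((g : Matrix (Fin 3) (Fin 3) (AdeleRing (𝓞 L) L)) *ᵥ ((algebraMap L (AdeleRing (𝓞 L) L)) ∘ v₀))
        ((g : Matrix (Fin 3) (Fin 3) (AdeleRing (𝓞 L) L)) *ᵥ ((algebraMap L (AdeleRing (𝓞 L) L)) ∘ v₀)))
    (w : {w : InfinitePlace L // IsComplex w}) :
    archKappaSignAt L H' (rationalArch L γH) w p.arch =
      hilbertSymbol (w.1.comap (algebraMap ↥(maximalRealSubfield L) L)).Completion
        ((ideleInfiniteComponent (↥(maximalRealSubfield L)) (w.1.comap (algebraMap ↥(maximalRealSubfield L) L)) W :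
            (w.1.comap (algebraMap ↥(maximalRealSubfield L) L)).Completion))
        (algebraMap ↥(maximalRealSubfield L) _ (cmQuadraticGenerator L : ↥(maximalRealSubfield L))) :=
  p.archKappaSignAt_arch_eq_hilbertSymbol hherm hanis hGreg hg hv₀ hv₀0 W hW w

end Arch

end Literature.NumberTheory.Rogawski1990

end
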